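import Summits.CriticalPhenomena.CardyFormulaZ2.Theorems.CardyComplexConeEdgePrecompactUFRSStrandsArmsPieces

/-!
# Strands ⇒ arms, IV: chains stay in their sectors; arms from sectors
(line `qkz-strip-boundary-arm` of crux `CardyComplexCone.EdgePrecompact`, stmt-CriticalPhenomena-11387;
the two halves of the sector argument for the registered sub-goal `ufrs_strands_zdDomArms` that
do not involve the three-arcs lemma)

* `segment_annulus`, `exists_mem_closure_of_probe`: two planar helpers (a unit-short segment with
  endpoints in an annulus stays in a slightly larger one; the first obstacle point on a probe
  segment lies in the closure of the component of its start).
* `chain_in_component`: along a chain of corners of an orbit of `nextCorner β` whose vertices and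
  face centres stay in the band `(r + 1, R - 1)`, the left vertices stay in ONE component and the
  right face centres in ONE component of the open annulus `(r + 1/2, R - 1/2)` minus any obstacle
  missing lattice points, face centres, open edges and closed dual steps (consecutive left
  vertices are joined by an open edge, consecutive right faces by a closed dual step).
* `arms_of_sectors` (registered sub-goal `ufrs_armsOfSectors`): the counting. If each of `k ≥ 2`
  strands has a left sector and a right sector, no sector belonging to three strands, a left walk
  inside its left sector (open edges) and a right walk inside its right sector (closed crossed
  edges), then there are `k` arms in the format of `ufrsArms` at mesh `1`: `≥ k/2` distinct
  sectors on each side (`Finset.card_le_mul_card_image`), walks in distinct sectors are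
  edge-disjoint (a common edge has a common endpoint), take `n_L = min(#left sectors, k-1) ≥ 1`
  open representatives and `k - n_L ≥ 1` dual ones.

References: M. Aizenman, A. Burchard, Duke Math. J. 99 (1999), Appendix A, Lemma A.5;
S. Smirnov, C. R. Acad. Sci. Paris 333 (2001), §2.
-/

namespace Summit.CriticalPhenomena.CardyFormulaZ2.Cruxes.EdgePrecompact.QkzStripBoundaryArm

open MeasureTheory Filter Set Metric Complex
open scoped Topology BigOperators Pointwise
open Literature.Probability.LatticeModels Literature.Probability.Percolation
open Literature.Probability.RandomPlanarGeometry (DobrushinDomain)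
open Summit.CriticalPhenomena.CardyFormulaZ2.Theses.CardyComplexCone
open Literature.Topology.PlaneTopology

noncomputable section

/-! ## Two planar helpers -/

/-- A unit-short segment whose endpoints are at distance in `(a₁, a₂)` from `z` stays at distance
in `(a₁ - 1/2, a₂)`: every point is within half the length of an endpoint. -/
theorem segment_annulus {A B z : ℂ} {a₁ a₂ : ℝ} (hA : a₁ < dist A z ∧ dist A z < a₂)
    (hB : a₁ < dist B z ∧ dist B z < a₂) (hAB : dist A B ≤ 1) :
    ∀ P ∈ segment ℝ A B, a₁ - 1 / 2 < dist P z ∧ dist P z < a₂ := by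
  intro P hP
  refine ⟨?_, ?_⟩
  · rw [segment_eq_image'] at hP
    obtain ⟨t, ⟨ht0, ht1⟩, rfl⟩ := hP
    by_cases ht : t ≤ 1 / 2
    · have h1 : dist (A + t • (B - A)) A ≤ 1 / 2 := by
        rw [dist_eq_norm, add_sub_cancel_left, norm_smul, Real.norm_eq_abs, abs_of_nonneg ht0, ← dist_eq_norm, dist_comm]
        nlinarith [dist_nonneg (x := A) (y := B)]
      linarith [dist_triangle A (A + t • (B - A)) z, dist_comm A (A + t • (B - A))]
    · have h1 : dist (A + t • (B - A)) B ≤ 1 / 2 := by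
        rw [dist_eq_norm, show A + t • (B - A) - B = (1 - t) • (A - B) by
          rw [sub_smul, one_smul, smul_sub, smul_sub]; abel, norm_smul, Real.norm_eq_abs,
          abs_of_nonneg (by linarith), ← dist_eq_norm]
        nlinarith [dist_nonneg (x := A) (y := B)]
      linarith [dist_triangle B (A + t • (B - A)) z, dist_comm B (A + t • (B - A))]
  · have := (convex_ball z a₂).segment_subset (mem_ball.2 hA.2) (mem_ball.2 hB.2) hP
    rwa [mem_ball] at this

/-- **Touching point on a probe segment.** If the segment `[A, B]` lies in `U`, starts off the
closed set `K` and meets `K`, and meets it only inside `D`, then some point of `D` lies in the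
closure of the connected component of `A` in `U ∖ K` (the first point of `K` on the segment). -/
theorem exists_mem_closure_of_probe {U K D : Set ℂ} {A B : ℂ} (hK : IsClosed K) (hA : A ∉ K)
    (hsub : segment ℝ A B ⊆ U) (hne : (segment ℝ A B ∩ K).Nonempty) (hD : segment ℝ A B ∩ K ⊆ D) :
    ∃ P ∈ D, P ∈ closure (connectedComponentIn (U \ K) A) := by
  set sg : Path A B := Path.segment A B with hsg
  have hsgmem : ∀ u, sg u ∈ segment ℝ A B := fun u => by rw [← Path.range_segment]; exact ⟨u, rfl⟩
  set Tm : Set unitInterval := {u | sg u ∈ K} with hTm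
  have hTmc : IsClosed Tm := hK.preimage sg.continuous
  have hTne : Tm.Nonempty := by
    obtain ⟨w, hw, hwK⟩ := hne
    rw [← Path.range_segment] at hw
    obtain ⟨u, rfl⟩ := hw
    exact ⟨u, hwK⟩
  obtain ⟨u₀, hu₀, hmin⟩ := hTmc.isCompact.exists_isLeast hTne
  have hu₀pos : 0 < u₀ := by
    rcases eq_or_lt_of_le (unitInterval.nonneg' (t := u₀)) with h | h
    · exfalso
      have h0 : sg u₀ = A := by rw [← h]; exact sg.source
      exact hA (h0 ▸ hu₀)
    · exact h
  refine ⟨sg u₀, hD ⟨hsgmem u₀, hu₀⟩, ?_⟩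
  have hsub' : sg '' Iio u₀ ⊆ connectedComponentIn (U \ K) A := by
    refine (isPreconnected_Iio.image sg sg.continuous.continuousOn).subset_connectedComponentIn
      ⟨0, hu₀pos, sg.source⟩ ?_
    rintro _ ⟨u, hu, rfl⟩
    exact ⟨hsub (hsgmem u), fun hK' => absurd (hmin hK') (not_le.2 hu)⟩
  refine closure_mono hsub' ?_
  have hne' : (Iio u₀).Nonempty := ⟨0, hu₀pos⟩
  have hu₀cl : u₀ ∈ closure (Iio u₀) := by rw [closure_Iio' hne']; exact self_mem_Iic
  exact (sg.continuous.continuousWithinAt).mem_closure_image hu₀cl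

/-! ## The chain of a strand stays in one complementary component on each side -/

/-- **The chain of a strand keeps its left vertices in one component and its right faces in one
component** of the open annulus `(r + 1/2, R - 1/2)` minus an obstacle `K` missing lattice
points, face centres, the edges open in `β` and the dual steps across edges closed in `β`
(consecutive left vertices are equal or joined by an open edge, consecutive right faces are equal
or joined by a closed dual step, and these segments stay in the annulus when the chain points are
at distance in `(r + 1, R - 1)`). -/
theorem chain_in_component (β : BondConfig (Site 2)) (q : Site 2 × Fin 4) (z : ℂ) {r R : ℝ} (K : Set ℂ)
    (hKv : ∀ u : Site 2, Site.toComplex u ∉ K) (hKc : ∀ g : Site 2, faceCenter g ∉ K)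
    (hKe : ∀ u w : Site 2, (zdGraph 2).Adj u w → s(u, w) ∈ β →
      ∀ P ∈ segment ℝ (Site.toComplex u) (Site.toComplex w), P ∉ K)
    (hKx : ∀ p : Site 2 × Fin 4, cTgt p ∉ β →
      ∀ P ∈ segment ℝ (faceCenter (cFace p)) (faceCenter (faceAt p.1 (p.2 + 1))), P ∉ K)
    {i' j' : ℕ}
    (hchain : ∀ t, i' ≤ t → t ≤ j' →
      r + 1 < dist (Site.toComplex (cornerOrbit β q t).1) z ∧ dist (Site.toComplex (cornerOrbit β q t).1) z < R - 1 ∧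
      r + 1 < dist (faceCenter (cFace (cornerOrbit β q t))) z ∧ dist (faceCenter (cFace (cornerOrbit β q t))) z < R - 1)
    {s t : ℕ} (hs : i' ≤ s) (hs' : s ≤ j') (ht : i' ≤ t) (ht' : t ≤ j') :
    Site.toComplex (cornerOrbit β q t).1 ∈ connectedComponentIn ({w | r + 1 / 2 < dist w z ∧ dist w z < R - 1 / 2} \ K)
        (Site.toComplex (cornerOrbit β q s).1) ∧
      faceCenter (cFace (cornerOrbit β q t)) ∈ connectedComponentIn ({w | r + 1 / 2 < dist w z ∧ dist w z < R - 1 / 2} \ K)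
        (faceCenter (cFace (cornerOrbit β q s))) := by
  set X : Set ℂ := {w | r + 1 / 2 < dist w z ∧ dist w z < R - 1 / 2} \ K with hX
  have hsegX : ∀ {A B : ℂ}, r + 1 < dist A z ∧ dist A z < R - 1 → r + 1 < dist B z ∧ dist B z < R - 1 →
      dist A B ≤ 1 → (∀ P ∈ segment ℝ A B, P ∉ K) →
      connectedComponentIn X A = connectedComponentIn X B := by
    intro A B hA hB hAB hK
    refine connectedComponentIn_eq ((convex_segment _ _).isPreconnected.subset_connectedComponentIn
      (left_mem_segment _ _ _) (fun P hP => ?_) (right_mem_segment _ _ _))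
    obtain ⟨h1, h2⟩ := segment_annulus hA hB hAB P hP
    exact ⟨⟨by linarith, by linarith⟩, hK P hP⟩
  -- one step
  have hstep : ∀ u, i' ≤ u → u + 1 ≤ j' →
      connectedComponentIn X (Site.toComplex (cornerOrbit β q u).1) = connectedComponentIn X (Site.toComplex (cornerOrbit β q (u + 1)).1) ∧
      connectedComponentIn X (faceCenter (cFace (cornerOrbit β q u))) = connectedComponentIn X (faceCenter (cFace (cornerOrbit β q (u + 1)))) := by
    intro u h1 h2
    have hc1 := hchain u h1 (by omega)
    have hc2 := hchain (u + 1) (by omega) h2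
    have hsucc : cornerOrbit β q (u + 1) = nextCorner β (cornerOrbit β q u) := rfl
    by_cases hopen : cTgt (cornerOrbit β q u) ∈ β
    · constructor
      · refine hsegX ⟨hc1.1, hc1.2.1⟩ ⟨hc2.1, hc2.2.1⟩ (by rw [dist_comm]; exact dist_vertex_succ_le β q u) ?_
        rw [hsucc, nextCorner_of_mem hopen]
        exact hKe _ _ ((SimpleGraph.mem_edgeSet _).1 (cTgt_mem_edgeSet (cornerOrbit β q u))) hopen
      · have hf : cFace (cornerOrbit β q (u + 1)) = cFace (cornerOrbit β q u) := by
          rw [hsucc]; exact cFace_nextCorner_of_mem hopen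
        rw [hf]
    · constructor
      · rw [hsucc, nextCorner_of_not_mem hopen]
      · refine hsegX ⟨hc1.2.2.1, hc1.2.2.2⟩ ⟨hc2.2.2.1, hc2.2.2.2⟩ (by rw [dist_comm]; exact dist_faceCenter_succ_le β q u) ?_
        have hf : cFace (cornerOrbit β q (u + 1)) = faceAt (cornerOrbit β q u).1 ((cornerOrbit β q u).2 + 1) := by
          rw [hsucc]; exact cFace_nextCorner_of_not_mem hopen
        rw [hf]
        exact hKx _ hopen
  -- along the chain
  have key : ∀ d, i' + d ≤ j' →
      connectedComponentIn X (Site.toComplex (cornerOrbit β q (i' + d)).1) = connectedComponentIn X (Site.toComplex (cornerOrbit β q i').1) ∧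
      connectedComponentIn X (faceCenter (cFace (cornerOrbit β q (i' + d)))) = connectedComponentIn X (faceCenter (cFace (cornerOrbit β q i'))) := by
    intro d
    induction d with
    | zero => intro; exact ⟨rfl, rfl⟩
    | succ d ih =>
      intro hd
      obtain ⟨e1, e2⟩ := ih (by omega)
      obtain ⟨f1, f2⟩ := hstep (i' + d) (by omega) (by omega)
      rw [← add_assoc, ← f1, ← f2]
      exact ⟨e1, e2⟩
  obtain ⟨es1, es2⟩ := key (s - i') (by omega)
  obtain ⟨et1, et2⟩ := key (t - i') (by omega)
  rw [show i' + (s - i') = s by omega] at es1 es2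
  rw [show i' + (t - i') = t by omega] at et1 et2
  have hct := hchain t ht ht'
  constructor
  · show _ ∈ connectedComponentIn X _
    rw [es1, ← et1]
    exact mem_connectedComponentIn ⟨⟨by linarith [hct.1], by linarith [hct.2.1]⟩, hKv _⟩
  · show _ ∈ connectedComponentIn X _
    rw [es2, ← et2]
    exact mem_connectedComponentIn ⟨⟨by linarith [hct.2.2.1], by linarith [hct.2.2.2]⟩, hKc _⟩

/-! ## From sectors to arms: the counting -/

/-- **Arms from sectors.** Given `k ≥ 2` strands with "left sectors" `cL a` and "right sectors"
`cR a` (sets such that two of them sharing a point are equal, and no three strands have the same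
sector), a left walk of each strand through sites whose points lie in its left sector and a right
(face) walk through faces whose centres lie in its right sector, with open edges / closed crossed
edges and the distance bookkeeping of `ufrsArms` at mesh `1`: there are `k` arms, not all of one
colour, same-colour arms edge-disjoint (`≥ k/2` distinct sectors on each side; walks in distinct
sectors share no edge). -/
theorem arms_of_sectors {k : ℕ} (hk : 2 ≤ k) (β : BondConfig (Site 2)) (z : ℂ) (r R : ℝ) (cL cR : Fin k → Set ℂ)
    (hcL : ∀ s₁ s₂ (P : ℂ), P ∈ cL s₁ → P ∈ cL s₂ → cL s₁ = cL s₂)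
    (hcR : ∀ s₁ s₂ (P : ℂ), P ∈ cR s₁ → P ∈ cR s₂ → cR s₁ = cR s₂)
    (hfibL : ∀ a₁ a₂ a₃ : Fin k, a₁ ≠ a₂ → a₂ ≠ a₃ → a₃ ≠ a₁ → cL a₁ = cL a₂ → cL a₂ = cL a₃ → False)
    (hfibR : ∀ a₁ a₂ a₃ : Fin k, a₁ ≠ a₂ → a₂ ≠ a₃ → a₃ ≠ a₁ → cR a₁ = cR a₂ → cR a₂ = cR a₃ → False)
    {xl yl xr yr : Fin k → Site 2} (WL : ∀ s, (zdGraph 2).Walk (xl s) (yl s)) (WR : ∀ s, (zdGraph 2).Walk (xr s) (yr s))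
    (hWLs : ∀ s, ∀ u ∈ (WL s).support, Site.toComplex u ∈ cL s ∧ r - 4 ≤ dist (Site.toComplex u) z ∧ dist (Site.toComplex u) z ≤ R + 4)
    (hWLe : ∀ s, ∀ e ∈ (WL s).edges, e ∈ β)
    (hWLends : ∀ s, (dist (Site.toComplex (xl s)) z ≤ r + 4 ∧ R - 4 ≤ dist (Site.toComplex (yl s)) z) ∨
      (dist (Site.toComplex (yl s)) z ≤ r + 4 ∧ R - 4 ≤ dist (Site.toComplex (xl s)) z))
    (hWRs : ∀ s, ∀ u ∈ (WR s).support, faceCenter u ∈ cR s ∧ r - 4 ≤ dist (Site.toComplex u) z ∧ dist (Site.toComplex u) z ≤ R + 4)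
    (hWRd : ∀ s, ∀ d ∈ (WR s).darts, sepEdge d.fst d.snd ∉ β)
    (hWRends : ∀ s, (dist (Site.toComplex (xr s)) z ≤ r + 4 ∧ R - 4 ≤ dist (Site.toComplex (yr s)) z) ∨
      (dist (Site.toComplex (yr s)) z ≤ r + 4 ∧ R - 4 ≤ dist (Site.toComplex (xr s)) z)) :
    ∃ (κ : Fin k → Bool) (x y : Fin k → Site 2) (W : ∀ a, (zdGraph 2).Walk (x a) (y a)),
      (∃ a b, κ a ≠ κ b) ∧
      (∀ a, dist (Site.toComplex (x a)) z ≤ r + 4 ∧ R - 4 ≤ dist (Site.toComplex (y a)) z ∧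
        (∀ u ∈ (W a).support, r - 4 ≤ dist (Site.toComplex u) z ∧ dist (Site.toComplex u) z ≤ R + 4) ∧
        (κ a = true → ∀ e ∈ (W a).edges, e ∈ β) ∧
        (κ a = false → ∀ e ∈ (W a).darts, sepEdge e.fst e.snd ∉ β)) ∧
      Pairwise (fun a b => κ a = κ b → ∀ e ∈ (W a).edges, e ∉ (W b).edges) := by
  classical
  /- counting distinct sectors -/
  set SL : Finset (Set ℂ) := Finset.univ.image cL with hSL
  set SR : Finset (Set ℂ) := Finset.univ.image cR with hSR
  have hcount : ∀ (f : Fin k → Set ℂ), (∀ a₁ a₂ a₃ : Fin k, a₁ ≠ a₂ → a₂ ≠ a₃ → a₃ ≠ a₁ → f a₁ = f a₂ → f a₂ = f a₃ → False) →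
      k ≤ 2 * (Finset.univ.image f).card := by
    intro f hfib
    have h := Finset.card_le_mul_card_image (Finset.univ : Finset (Fin k)) (f := f) 2 ?_
    · simpa using h
    intro y _
    by_contra hgt
    push Not at hgt
    obtain ⟨l₁, hl₁, l₂, hl₂, l₃, hl₃, h12, h13, h23⟩ := Finset.two_lt_card.1 hgt
    simp only [Finset.mem_filter, Finset.mem_univ, true_and] at hl₁ hl₂ hl₃
    exact hfib l₁ l₂ l₃ h12 h23 (Ne.symm h13) (hl₁.trans hl₂.symm) (hl₂.trans hl₃.symm)
  have hcardL : k ≤ 2 * SL.card := hcount cL hfibL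
  have hcardR : k ≤ 2 * SR.card := hcount cR hfibR
  have hrepL : ∀ C ∈ SL, ∃ a, cL a = C := fun C hC => by
    obtain ⟨a, -, ha⟩ := Finset.mem_image.1 hC; exact ⟨a, ha⟩
  have hrepR : ∀ C ∈ SR, ∃ a, cR a = C := fun C hC => by
    obtain ⟨a, -, ha⟩ := Finset.mem_image.1 hC; exact ⟨a, ha⟩
  haveI : Nonempty (Fin k) := ⟨⟨0, by omega⟩⟩
  choose! repL hrepL' using hrepL
  choose! repR hrepR' using hrepR
  set nL : ℕ := min SL.card (k - 1) with hnL
  have hnL1 : 1 ≤ nL := by simp only [hnL, le_min_iff]; omega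
  have hnLk : nL ≤ k - 1 := min_le_right _ _
  have hnR : k - nL ≤ SR.card := by
    simp only [hnL]
    rcases le_total SL.card (k - 1) with h | h
    · rw [min_eq_left h]; omega
    · rw [min_eq_right h]; omega
  obtain ⟨gL, hgLinj, hgLmem⟩ := exists_injective_of_le_card (S := SL) (j := nL) (min_le_left _ _)
  obtain ⟨gR, hgRinj, hgRmem⟩ := exists_injective_of_le_card (S := SR) (j := k - nL) hnR
  /- oriented walks -/
  have harmL : ∀ s, ∃ (x y : Site 2) (W : (zdGraph 2).Walk x y),
      dist (Site.toComplex x) z ≤ r + 4 ∧ R - 4 ≤ dist (Site.toComplex y) z ∧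
      (∀ u ∈ W.support, u ∈ (WL s).support) ∧ (∀ e ∈ W.edges, e ∈ (WL s).edges) := by
    intro s
    rcases hWLends s with ⟨h1, h2⟩ | ⟨h1, h2⟩
    · exact ⟨xl s, yl s, WL s, h1, h2, fun u hu => hu, fun e he => he⟩
    · refine ⟨yl s, xl s, (WL s).reverse, h1, h2, fun u hu => ?_, fun e he => ?_⟩
      · rwa [SimpleGraph.Walk.support_reverse, List.mem_reverse] at hu
      · rwa [SimpleGraph.Walk.edges_reverse, List.mem_reverse] at he
  have harmR : ∀ s, ∃ (x y : Site 2) (W : (zdGraph 2).Walk x y),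
      dist (Site.toComplex x) z ≤ r + 4 ∧ R - 4 ≤ dist (Site.toComplex y) z ∧
      (∀ u ∈ W.support, u ∈ (WR s).support) ∧ (∀ e ∈ W.edges, e ∈ (WR s).edges) ∧
      (∀ d ∈ W.darts, sepEdge d.fst d.snd ∉ β) := by
    intro s
    rcases hWRends s with ⟨h1, h2⟩ | ⟨h1, h2⟩
    · exact ⟨xr s, yr s, WR s, h1, h2, fun u hu => hu, fun e he => he, hWRd s⟩
    · refine ⟨yr s, xr s, (WR s).reverse, h1, h2, fun u hu => ?_, fun e he => ?_, fun d hd => ?_⟩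
      · rwa [SimpleGraph.Walk.support_reverse, List.mem_reverse] at hu
      · rwa [SimpleGraph.Walk.edges_reverse, List.mem_reverse] at he
      · rw [SimpleGraph.Walk.darts_reverse, List.mem_reverse, List.mem_map] at hd
        obtain ⟨d', hd', rfl⟩ := hd
        rw [SimpleGraph.Dart.symm_toProd, Prod.fst_swap, Prod.snd_swap, sepEdge_comm]
        exact hWRd s d' hd'
  choose xL yL AL hAL1 hAL2 hALs hALe using harmL
  choose xR yR AR hAR1 hAR2 hARs hARe hARd using harmR
  /- walks in different sectors share no edge -/
  have hshare : ∀ {x₁ y₁ x₂ y₂ : Site 2} (W₁ : (zdGraph 2).Walk x₁ y₁) (W₂ : (zdGraph 2).Walk x₂ y₂) (e : Sym2 (Site 2)),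
      e ∈ W₁.edges → e ∈ W₂.edges → ∃ u, u ∈ W₁.support ∧ u ∈ W₂.support := by
    intro x₁ y₁ x₂ y₂ W₁ W₂ e he₁ he₂
    rw [SimpleGraph.Walk.edges, List.mem_map] at he₁
    obtain ⟨d, hd, rfl⟩ := he₁
    exact ⟨d.fst, SimpleGraph.Walk.dart_fst_mem_support_of_mem_darts _ hd,
      SimpleGraph.Walk.fst_mem_support_of_mem_edges _ (he₂ : s(d.fst, d.snd) ∈ _)⟩
  have hshareL : ∀ s₁ s₂ e, e ∈ (WL s₁).edges → e ∈ (WL s₂).edges → cL s₁ = cL s₂ := by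
    intro s₁ s₂ e he₁ he₂
    obtain ⟨u, hu₁, hu₂⟩ := hshare _ _ e he₁ he₂
    exact hcL s₁ s₂ _ (hWLs s₁ u hu₁).1 (hWLs s₂ u hu₂).1
  have hshareR : ∀ s₁ s₂ e, e ∈ (WR s₁).edges → e ∈ (WR s₂).edges → cR s₁ = cR s₂ := by
    intro s₁ s₂ e he₁ he₂
    obtain ⟨u, hu₁, hu₂⟩ := hshare _ _ e he₁ he₂
    exact hcR s₁ s₂ _ (hWRs s₁ u hu₁).1 (hWRs s₂ u hu₂).1
  /- the arms -/
  set arm : Fin k → Σ x y : Site 2, (zdGraph 2).Walk x y := fun a =>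
    if h : (a : ℕ) < nL then ⟨xL (repL (gL ⟨a, h⟩)), yL (repL (gL ⟨a, h⟩)), AL (repL (gL ⟨a, h⟩))⟩
    else ⟨xR (repR (gR ⟨a - nL, by have := a.isLt; omega⟩)), yR (repR (gR ⟨a - nL, by have := a.isLt; omega⟩)), AR (repR (gR ⟨a - nL, by have := a.isLt; omega⟩))⟩ with harm
  have harm_pos : ∀ (a : Fin k) (h : (a : ℕ) < nL), arm a = ⟨xL (repL (gL ⟨a, h⟩)), yL (repL (gL ⟨a, h⟩)), AL (repL (gL ⟨a, h⟩))⟩ :=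
    fun a h => dif_pos h
  have harm_neg : ∀ (a : Fin k) (h : ¬ (a : ℕ) < nL),
      arm a = ⟨xR (repR (gR ⟨a - nL, by have := a.isLt; omega⟩)), yR (repR (gR ⟨a - nL, by have := a.isLt; omega⟩)), AR (repR (gR ⟨a - nL, by have := a.isLt; omega⟩))⟩ :=
    fun a h => dif_neg h
  refine ⟨fun a => decide ((a : ℕ) < nL), fun a => (arm a).1, fun a => (arm a).2.1, fun a => (arm a).2.2,
    ⟨⟨0, by omega⟩, ⟨k - 1, by omega⟩, by simp; omega⟩, fun a => ?_, ?_⟩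
  · dsimp only
    by_cases h : (a : ℕ) < nL
    · rw [harm_pos a h]
      refine ⟨hAL1 _, hAL2 _, fun u hu => (hWLs _ u (hALs _ u hu)).2, fun _ e he => hWLe _ e (hALe _ e he), fun hκ => ?_⟩
      simp [h] at hκ
    · rw [harm_neg a h]
      refine ⟨hAR1 _, hAR2 _, fun u hu => (hWRs _ u (hARs _ u hu)).2, fun hκ => ?_, fun _ => hARd _⟩
      simp [h] at hκ
  · intro a b hab hκ e hea heb
    dsimp only at hea heb
    simp only [decide_eq_decide] at hκ
    by_cases ha : (a : ℕ) < nL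
    · have hb : (b : ℕ) < nL := hκ.1 ha
      rw [harm_pos a ha] at hea
      rw [harm_pos b hb] at heb
      have hs := hshareL _ _ e (hALe _ e hea) (hALe _ e heb)
      rw [hrepL' _ (hgLmem _), hrepL' _ (hgLmem _)] at hs
      have := hgLinj hs
      apply hab
      apply Fin.ext
      simpa using this
    · have hb : ¬ (b : ℕ) < nL := fun hb => ha (hκ.2 hb)
      rw [harm_neg a ha] at hea
      rw [harm_neg b hb] at heb
      have hs := hshareR _ _ e (hARe _ e hea) (hARe _ e heb)
      rw [hrepR' _ (hgRmem _), hrepR' _ (hgRmem _)] at hs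
      have := hgRinj hs
      apply hab
      apply Fin.ext
      have := Fin.mk.inj_iff.1 this
      omega

/-- **Arms from sectors** (registered sub-goal `ufrs_armsOfSectors` of stmt-CriticalPhenomena-11387;
the counting step of the sector argument for `ufrs_strands_zdDomArms`, `arms_of_sectors` in
registered form). -/
theorem ufrs_armsOfSectors : ∀ (k : ℕ), 2 ≤ k → ∀ (β : BondConfig (Site 2)) (z : ℂ) (r R : ℝ) (cL cR : Fin k → Set ℂ), (∀ s₁ s₂ (P : ℂ), P ∈ cL s₁ → P ∈ cL s₂ → cL s₁ = cL s₂) → (∀ s₁ s₂ (P : ℂ), P ∈ cR s₁ → P ∈ cR s₂ → cR s₁ = cR s₂) → (∀ a₁ a₂ a₃ : Fin k, a₁ ≠ a₂ → a₂ ≠ a₃ → a₃ ≠ a₁ → cL a₁ = cL a₂ → cL a₂ = cL a₃ → False) → (∀ a₁ a₂ a₃ : Fin k, a₁ ≠ a₂ → a₂ ≠ a₃ → a₃ ≠ a₁ → cR a₁ = cR a₂ → cR a₂ = cR a₃ → False) → ∀ (xl yl xr yr : Fin k → Site 2) (WL : ∀ s, (zdGraph 2).Walk (xl s) (yl s)) (WR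 : ∀ s, (zdGraph 2).Walk (xr s) (yr s)), (∀ s, ∀ u ∈ (WL s).support, Site.toComplex u ∈ cL s ∧ r - 4 ≤ dist (Site.toComplex u) z ∧ dist (Site.toComplex u) z ≤ R + 4) → (∀ s, ∀ e ∈ (WL s).edges, e ∈ β) → (∀ s, (dist (Site.toComplex (xl s)) z ≤ r + 4 ∧ R - 4 ≤ dist (Site.toComplex (yl s)) z) ∨ (dist (Site.toComplex (yl s)) z ≤ r + 4 ∧ R - 4 ≤ dist (Site.toComplex (xl s)) z)) → (∀ s, ∀ u ∈ (WR s).support, faceCenter u ∈ cR s ∧ r - 4 ≤ dist (Site.toComplex u) z ∧ dist (Site.toComplex u) z ≤ R + 4) → (∀ s, ∀ d ∈ (WR s).darts, sepEdge d.fst d.snd ∉ β) → (∀ s, (dist (Site.toComplex (xr s)) z ≤ r + 4 ∧ R - 4 ≤ dist (Site.toComplex (yr s)) z) ∨ (dist (Site.toComplex (yr s)) z ≤ r + 4 ∧ R - 4 ≤ dist (Site.toComplex (xr s)) z)) → ∃ (κ : Fin k → Bool) (x y : Fin k → Site 2) (W : ∀ a, (zdGraph 2).Walk (x a) (y a)),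 (∃ a b, κ a ≠ κ b) ∧ (∀ a, dist (Site.toComplex (x a)) z ≤ r + 4 ∧ R - 4 ≤ dist (Site.toComplex (y a)) z ∧ (∀ u ∈ (W a).support, r - 4 ≤ dist (Site.toComplex u) z ∧ dist (Site.toComplex u) z ≤ R + 4) ∧ (κ a = true → ∀ e ∈ (W a).edges, e ∈ β) ∧ (κ a = false → ∀ e ∈ (W a).darts, sepEdge e.fst e.snd ∉ β)) ∧ Pairwise (fun a b => κ a = κ b → ∀ e ∈ (W a).edges, e ∉ (W b).edges) :=
  fun _k hk β z r R cL cR hcL hcR hfibL hfibR _xl _yl _xr _yr WL WR hWLs hWLe hWLends hWRs hWRd hWRends =>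
    arms_of_sectors hk β z r R cL cR hcL hcR hfibL hfibR WL WR hWLs hWLe hWLends hWRs hWRd hWRends

end

end Summit.CriticalPhenomena.CardyFormulaZ2.Cruxes.EdgePrecompact.QkzStripBoundaryArm
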